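import Summits.ABC.IUTFork.Repair.RHLinearReachLaw
import Summits.ABC.IUTFork.Repair.RHShellCapacityPlus
import HarnessLib

/-!
# D-0079 RESCUE sub-cell R-H, ROUND 1 (D-0107), row 20 `linear-reach-law` — `RHLinearReachLawGenuine` (2/2): THE DECIDING DECLARATION H⋆₂₀
# `RH.LinearReachLaw.HStar X` over the genuine pilot-datum currency (`Cor312Prov.pilotDataOfK D K`, the unit-log lattice of the rescaled
# completion `K_x = kOf X p x`), its column deciders for k1, and kernel witnesses at the named cells of I06STAR-COLUMNS

[R-H candidate — a HYPOTHESIS, claim-tagged `def … : Prop`; never a Literature fact; typed ≠ proved; instantiated ≠ endorsed.] Seat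
abc-iut-rh-typ-7 gen 2 (pair 7 → row 20; tester abc-iut-rh-tst-7; k2 desk rotation rp-d3 → rp-s2 → rp-d1 → rp-j2; lead abc-iut-rh-lead g0).
TAKES NO SIDE on [IUTchIII] Cor. 3.12 or on any author; nothing here asserts abc proved or refuted. Vocabulary: `Repair/RHLinearReachLaw.lean` (1/2).

THE TYPING (column vocabulary of `plan/rescue/R-H/I06STAR-COLUMNS.tsv` v1 2e4c48fd4267a5a7 cols 1–30, v2.1+ cols 31–32 ↔ the tree). At a bad
place `x | p` of a pilot datum `X` (abc-iut-c312-7's fibre point, `placeOf X p x ∈ X.S`), `K_x = kOf X p x`, `e_x = e(x|p) = absRamificationIdx p K_x`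
(`RH.ShellCapacityPlus.absRamificationIdx_kOf`), `ord_x(q) = X.ordq (placeOf X p x)`, so the table's `m_w = e_w·H/(2l) = ord_x(q)/(2l)`. ROW 20
VERBATIM: «for all bad w|p (unique over p), all j <= l*: (j^2−1)·m_w + e_w <= (j+1)·D_w, D_w = (e_w − 1) + (c_w − B_w); c_w = inner conductor,
B_w = outer order of log_p(O_w^x); m_w = e_w·H/(2l)». **`CellAt X p i x`** := for every norm uniformizer `ϖ` of `K_x` and the inner conductor `c`
/ outer order `B` of `log_p(𝒪_{K_x}^×)` (`IsInnerConductor`, `IsOuterOrder`), `((i+1)² − 1)·ord_x(q) + 2l·e_x ≤ 2l·(i+2)·((e_x − 1) + (c − B))`;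
**`HStar X`** := `CellAt` at EVERY bad place and EVERY label (the k1 datum verdict «all cells hold»; the row's «unique over p» is the reach of
the k2 door of record `Thm311.Real.qRegion_subset_thetaHull_settingPrVolSharp_of_movers` (`huniq`), recorded, not a restriction of the demand).
WHAT IS PROVED: `cellAt_iff_of_certs` (certified integers ⇒ the cell IS the integer cell); `cellAt_iff_forall_hStarLinearReachLaw` (FAITHFULNESS:
at `ord_x(q) = 2l·m` the cell is the author's `HStarLinearReachLaw p K_x ϖ (i+1) m` for every uniformizer); `not_cellAt_of_not_col` (COLUMN-NEG ⇒
H⋆₂₀-NEG at every field of the type, ties included); `cellAt_iff_col_of_not_dvd` (`(p−1) ∤ e_x`: the column cell DECIDES H⋆₂₀); §T4 the same at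
`pilotDataOfK D K` (`ord_x(q) = e(x|v)·ord_v(q_v)`, `Cor312Prov.ordq_pilotDataOfK`); §T5 kernel witnesses: the k4 cell HEX:2:11@p7.j5.ev1 (H⋆₂₀ POS
in the kernel at every `K/ℚ_7`-place of type `e = 11`, `ord(q) = 44`, while I06⋆ is NEG there — `cellAt_hex_2_11`), the two cells where rows 15
and 20 DIFFER (lamSeven:k=4:l=23 law POS / slot cell NEG; HEX:3:5 tame law NEG / licence cell POS — neither row nests in the other), the declared A6
slice edge `HEX:l11:ev1 → k₀ = 3`. k1 OF RECORD (abc-iut-rh-num-1 `plan/rescue/R-H/HULL-REACH-K1.txt` 17:07Z, `(c, B) = (r_in_ub, r_out_sharp)`):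
pooled 1118 POS + 415 POS* (tie rows) / 2570 groups = 59.6 % (43.5 % untied-certified), lamSeven (68 + 28*)/256, HEX strip (122 + 56*)/272,
frey:szpiro-bad 297/876, szpiro-bad∧window (600 + 323*)/1076, hex-v2 23/73, concrete 4/5; POS ∩ R-W-refuted = 0/711 ⇒ < 95 %: KILL(k1) pooled by
the verbatim rule of START-HERE §3 (slices: `HOME/staging/RH/abc-iut-rh-typ-7/K1-linear-reach-law.md`). [cite: Mochizuki2012, IUTchI Def. 3.1 (b)(c)
p. 61, Ex. 3.2 (iv) p. 71; IUTchIII Thm. 3.11 (i) (Ind2) p. 154] [cite: NeukirchANT1999, Ch. II (5.5)] [cite: DupuyHilado2025, §3.3]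
[claim: Mochizuki2012, status: disputed] for every IUT sentence quoted. 0 sorry; standard axioms.
-/

noncomputable section

open Set Metric Function NumberField IsDedekindDomain
open scoped Pointwise

namespace Summit.ABC.IUTFork.Repair.RH.LinearReachLaw

open Metric Set Literature.IUT.LogVolume Literature.NumberTheory.GaloisRepresentations.Ultrametric

/-! ## §T3. (typer) THE CANDIDATE H⋆₂₀ OVER A PILOT DATUM and its deciders -/

section Candidate

open Literature.IUT.LogThetaLattice Thm311 Thm311.Real Cor312 Cor312Vol Cor312Prov
  Summit.ABC.IUTFork.Repair.RH.ShellCapacityPlus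

variable {F : Type} [Field F] [NumberField F] (X : PilotData F)

/-- **H⋆₂₀'s CELL at a bad place `x | p` and label `j = i+1`**: for every norm uniformizer `ϖ` of `K_x = kOf X p x` and the inner conductor `c` /
outer order `B` of `log_p(𝒪_{K_x}^×)`, the `2l`-cleared linear reach law `((i+1)² − 1)·ord_x(q) + 2l·e_x ≤ 2l·(i+2)·((e_x − 1) + (c − B))`
(row 20: «(j^2−1)·m_w + e_w <= (j+1)·D_w, D_w = (e_w − 1) + (c_w − B_w)», `m_w = ord_x(q)/(2l)`). A claim-tagged HYPOTHESIS; asserts nothing.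
[cite: Mochizuki2012, IUTchIII Thm. 3.11 (i) (Ind2) p. 154] [claim: Mochizuki2012, status: disputed] -/
@[claim "Mochizuki2012" "disputed"]
def CellAt (pp : Nat.Primes) (i : Fin X.lstar) (x : (thetaIndex X).Fibre (.inr pp)) : Prop :=
  haveI : Fact (pp : ℕ).Prime := ⟨pp.2⟩
  ∀ (ϖ : (kOf X pp.1 x)ˣ), IsUniformizer ϖ → ∀ (c : ℕ) (B : ℤ),
    IsInnerConductor (kOf X pp.1 x) ϖ c → IsOuterOrder (kOf X pp.1 x) ϖ B →
      LinearLaw2l ((placeOf X pp.1 x).asIdeal.ramificationIdx ℤ : ℤ) (c : ℤ) B ((i : ℕ) + 1)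
        (X.ordq (placeOf X pp.1 x)) X.l

/-- **H⋆₂₀ «linear-reach-law»** (row 20 of RH-CANDIDATES v1.5, author abc-iut-lens-control-1): «for all bad w|p (unique over p), all j <= l*:
(j^2−1)·m_w + e_w <= (j+1)·D_w, D_w = (e_w − 1) + (c_w − B_w); c_w = inner conductor, B_w = outer order of log_p(O_w^x); m_w = e_w·H/(2l)» — the
cell `CellAt` at EVERY bad place `x` of the pilot datum `X` and EVERY label (the k1 recipe's datum verdict «datum holds iff all its cells hold»;
the row's scope note «unique over p» is the reach of the k2 door of record, `Thm311.Real.qRegion_subset_thetaHull_settingPrVolSharp_of_movers`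
(`huniq`), not a restriction of the demand). Instantiate `X := Cor312Prov.pilotDataOfK D K` (§T4). A claim-tagged HYPOTHESIS over the genuine
currency; never asserted. [cite: Mochizuki2012, IUTchIII Thm. 3.11 (i) (Ind2) p. 154] [claim: Mochizuki2012, status: disputed] -/
@[claim "Mochizuki2012" "disputed"]
def HStar : Prop :=
  ∀ (pp : Nat.Primes) (i : Fin X.lstar) (x : (thetaIndex X).Fibre (.inr pp)),
    haveI : Fact (pp : ℕ).Prime := ⟨pp.2⟩
    placeOf X pp.1 x ∈ X.S → CellAt X pp i x

/-- **DECIDER**: once the two lattice integers of `K_x` are certified for ONE uniformizer (`IsInnerConductor c₀`, `IsOuterOrder B₀`), H⋆₂₀'s cell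
IS the integer cell `LinearLaw2l e_x c₀ B₀ (i+1) ord_x(q) l` (uniqueness of the integers; independence of the uniformizer). [folklore] -/
theorem cellAt_iff_of_certs (pp : Nat.Primes) [Fact (pp : ℕ).Prime] (i : Fin X.lstar) (x : (thetaIndex X).Fibre (.inr pp))
    {ϖ : (kOf X pp.1 x)ˣ} (hϖ : IsUniformizer ϖ) {c₀ : ℕ} {B₀ : ℤ} (hc : IsInnerConductor (kOf X pp.1 x) ϖ c₀)
    (hB : IsOuterOrder (kOf X pp.1 x) ϖ B₀) :
    CellAt X pp i x ↔
      LinearLaw2l ((placeOf X pp.1 x).asIdeal.ramificationIdx ℤ : ℤ) (c₀ : ℤ) B₀ ((i : ℕ) + 1) (X.ordq (placeOf X pp.1 x)) X.l := by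
  constructor
  · intro h; exact h ϖ hϖ c₀ B₀ hc hB
  · intro h ϖ' hϖ' c B hc' hB'
    have hn : ‖((ϖ' : (kOf X pp.1 x)ˣ) : kOf X pp.1 x)‖ = ‖((ϖ : (kOf X pp.1 x)ˣ) : kOf X pp.1 x)‖ :=
      norm_eq_norm_of_isUniformizer (kOf X pp.1 x) hϖ' hϖ
    rw [isInnerConductor_congr hn] at hc'
    rw [isOuterOrder_congr hn] at hB'
    rw [isInnerConductor_unique hc' hc, isOuterOrder_unique hϖ hB' hB]
    exact h

/-- **FAITHFULNESS TO §A**: when `ord_x(q) = 2l·m` (realising data: `m = m_w = ord_ϖ(q̲_x)`), H⋆₂₀'s cell IS the author's cell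
`HStarLinearReachLaw p K_x ϖ (i+1) m` for every norm uniformizer `ϖ` (`e(K_x/ℚ_p) = e(x|p)`, `RH.ShellCapacityPlus.absRamificationIdx_kOf`).
[cite: Mochizuki2012, IUTchI Ex. 3.2 (iv) p. 71] [claim: Mochizuki2012, status: disputed] -/
theorem cellAt_iff_forall_hStarLinearReachLaw (pp : Nat.Primes) [Fact (pp : ℕ).Prime] (i : Fin X.lstar)
    (x : (thetaIndex X).Fibre (.inr pp)) {m : ℤ} (hm : X.ordq (placeOf X pp.1 x) = 2 * X.l * m) :
    CellAt X pp i x ↔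
      ∀ ϖ : (kOf X pp.1 x)ˣ, IsUniformizer ϖ → HStarLinearReachLaw pp (kOf X pp.1 x) ϖ ((i : ℕ) + 1) m := by
  have hl : 0 < X.l := by have := X.five_le_l; omega
  unfold CellAt HStarLinearReachLaw
  refine forall_congr' fun ϖ => forall_congr' fun _ => forall_congr' fun c => forall_congr' fun B =>
    forall_congr' fun _ => forall_congr' fun _ => ?_
  rw [absRamificationIdx_kOf X pp x, linearLaw2l_iff hl hm]

/-- **COLUMN-NEG ⇒ H⋆₂₀-NEG, UNCONDITIONALLY** (every `p`, every `e_x`, tie rows included): if the integer cell FAILS at the column values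
`c := ⌊e_x/(p−1)⌋ + 1 = r_in_ub(x)`, `B := p^{a₀} − e_x·a₀ = r_out_sharp(x)` (`a₀` any turning point of `e_x`), then H⋆₂₀'s cell fails at `x`.
This is the certificate behind every NEG cell of the k1 evaluation. [cite: NeukirchANT1999, Ch. II (5.5)] [claim: Mochizuki2012, status: disputed] -/
theorem not_cellAt_of_not_col (pp : Nat.Primes) [Fact (pp : ℕ).Prime] (i : Fin X.lstar) (x : (thetaIndex X).Fibre (.inr pp)) {a₀ : ℕ}
    (hlo : ∀ a < a₀, ((pp : ℕ) : ℤ) ^ a * (((pp : ℕ) : ℤ) - 1) < (placeOf X pp.1 x).asIdeal.ramificationIdx ℤ)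
    (hhi : ((placeOf X pp.1 x).asIdeal.ramificationIdx ℤ : ℤ) ≤ ((pp : ℕ) : ℤ) ^ a₀ * (((pp : ℕ) : ℤ) - 1))
    (hneg : ¬ LinearLaw2l ((placeOf X pp.1 x).asIdeal.ramificationIdx ℤ : ℤ)
      (((placeOf X pp.1 x).asIdeal.ramificationIdx ℤ / ((pp : ℕ) - 1) + 1 : ℕ) : ℤ)
      (((pp : ℕ) : ℤ) ^ a₀ - ((placeOf X pp.1 x).asIdeal.ramificationIdx ℤ : ℤ) * (a₀ : ℤ)) ((i : ℕ) + 1)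
      (X.ordq (placeOf X pp.1 x)) X.l) :
    ¬ CellAt X pp i x := by
  intro h
  have he : absRamificationIdx pp (kOf X pp.1 x) = (placeOf X pp.1 x).asIdeal.ramificationIdx ℤ := absRamificationIdx_kOf X pp x
  have hϖ := isUniformizer_unifChoice (kOf X pp.1 x)
  obtain ⟨c, hc⟩ := exists_isInnerConductor (pp : ℕ) hϖ
  obtain ⟨B, hB⟩ := exists_isOuterOrder (pp : ℕ) hϖ
  have hcle := isInnerConductor_le (pp : ℕ) hϖ hc
  rw [← he] at hlo hhi
  have hBge := le_of_isOuterOrder (pp : ℕ) hϖ hB hlo hhi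
  rw [he] at hcle hBge
  exact hneg (linearLaw2l_mono_cert (by exact_mod_cast hcle) hBge (h _ hϖ c B hc hB))

/-- **COLUMN CELL ⟺ H⋆₂₀ CELL when `(p−1) ∤ e_x`** (untied rows; `a₀` the strict turning point of `e_x`): the k1 evaluation at
`(c, B) = (r_in_ub, r_out_sharp)` DECIDES H⋆₂₀'s cell at every field of that type. [cite: NeukirchANT1999, Ch. II (5.5)]
[claim: Mochizuki2012, status: disputed] -/
theorem cellAt_iff_col_of_not_dvd (pp : Nat.Primes) [Fact (pp : ℕ).Prime] (i : Fin X.lstar) (x : (thetaIndex X).Fibre (.inr pp))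
    (hnd : ¬ ((pp : ℕ) - 1 ∣ (placeOf X pp.1 x).asIdeal.ramificationIdx ℤ)) {a₀ : ℕ}
    (hlo : ∀ a < a₀, ((pp : ℕ) : ℤ) ^ a * (((pp : ℕ) : ℤ) - 1) < (placeOf X pp.1 x).asIdeal.ramificationIdx ℤ)
    (hhi : ((placeOf X pp.1 x).asIdeal.ramificationIdx ℤ : ℤ) < ((pp : ℕ) : ℤ) ^ a₀ * (((pp : ℕ) : ℤ) - 1)) :
    CellAt X pp i x ↔
      LinearLaw2l ((placeOf X pp.1 x).asIdeal.ramificationIdx ℤ : ℤ)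
        (((placeOf X pp.1 x).asIdeal.ramificationIdx ℤ / ((pp : ℕ) - 1) + 1 : ℕ) : ℤ)
        (((pp : ℕ) : ℤ) ^ a₀ - ((placeOf X pp.1 x).asIdeal.ramificationIdx ℤ : ℤ) * (a₀ : ℤ)) ((i : ℕ) + 1)
        (X.ordq (placeOf X pp.1 x)) X.l := by
  have he : absRamificationIdx pp (kOf X pp.1 x) = (placeOf X pp.1 x).asIdeal.ramificationIdx ℤ := absRamificationIdx_kOf X pp x
  have hϖ := isUniformizer_unifChoice (kOf X pp.1 x)
  rw [← he] at hnd hlo hhi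
  have hc := isInnerConductor_of_not_dvd (pp : ℕ) hϖ hnd
  have hB := isOuterOrder_envelope (pp : ℕ) hϖ hlo hhi
  rw [he] at hc hB
  exact cellAt_iff_of_certs X pp i x hϖ hc hB

/-- A failed cell at a bad place refutes H⋆₂₀ at the datum. [folklore] -/
theorem not_hStar_of_not_cellAt (pp : Nat.Primes) [Fact (pp : ℕ).Prime] (i : Fin X.lstar) (x : (thetaIndex X).Fibre (.inr pp))
    (hx : placeOf X pp.1 x ∈ X.S) (hneg : ¬ CellAt X pp i x) : ¬ HStar X := fun h => hneg (h pp i x hx)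

end Candidate

/-! ## §T4. (typer) At print's own `K`-level pilot datum `pilotDataOfK D K` -/

section Genuine

open Thm311 Thm311.Real Cor312 Cor312Vol Cor312Prov Literature.IUT.HodgeTheaters
  Summit.ABC.IUTFork.Repair.RH.ShellCapacityPlus

variable {F K Fbar : Type} [Field F] [NumberField F] [Field K] [NumberField K] [Algebra F K] [Field Fbar]
  [Algebra F Fbar] [Algebra K Fbar] {E : WeierstrassCurve F} [E.IsElliptic] {l : ℕ} {Pb : BadPlacePredicates K}
  (D : InitialThetaData F K Fbar E l Pb)

/-- **k1 DECIDER AT `pilotDataOfK D K` (untied rows)**: at a bad place `x | p` of `K` over `v ∈ 𝕍(F)^bad` with `(p−1) ∤ e_x` and strict turning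
point `a₀`, H⋆₂₀'s cell at label `j = i+1` holds IFF `((i+1)² − 1)·e(x|v)·ord_v(q_v) + 2l·e_x ≤ 2l·(i+2)·((e_x − 1) + (r_in_ub − r_out_sharp))`
(`ord_x(q) = e(x|v)·ord_v(q_v)`, `Cor312Prov.ordq_pilotDataOfK`; [IUTchI] Def. 3.1 (c)). [cite: Mochizuki2012, IUTchI Def. 3.1 (c) p. 61]
[claim: Mochizuki2012, status: disputed] -/
theorem cellAt_pilotDataOfK_iff_col_of_not_dvd (pp : Nat.Primes) [Fact (pp : ℕ).Prime] (i : Fin (pilotDataOfK D K).lstar)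
    (x : (thetaIndex (pilotDataOfK D K)).Fibre (.inr pp)) (hx : placeOf (pilotDataOfK D K) pp.1 x ∈ (pilotDataOfK D K).S)
    (hnd : ¬ ((pp : ℕ) - 1 ∣ (placeOf (pilotDataOfK D K) pp.1 x).asIdeal.ramificationIdx ℤ)) {a₀ : ℕ}
    (hlo : ∀ a < a₀, ((pp : ℕ) : ℤ) ^ a * (((pp : ℕ) : ℤ) - 1) < (placeOf (pilotDataOfK D K) pp.1 x).asIdeal.ramificationIdx ℤ)
    (hhi : ((placeOf (pilotDataOfK D K) pp.1 x).asIdeal.ramificationIdx ℤ : ℤ) < ((pp : ℕ) : ℤ) ^ a₀ * (((pp : ℕ) : ℤ) - 1)) :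
    CellAt (pilotDataOfK D K) pp i x ↔
      LinearLaw2l ((placeOf (pilotDataOfK D K) pp.1 x).asIdeal.ramificationIdx ℤ : ℤ)
        (((placeOf (pilotDataOfK D K) pp.1 x).asIdeal.ramificationIdx ℤ / ((pp : ℕ) - 1) + 1 : ℕ) : ℤ)
        (((pp : ℕ) : ℤ) ^ a₀ - ((placeOf (pilotDataOfK D K) pp.1 x).asIdeal.ramificationIdx ℤ : ℤ) * (a₀ : ℤ)) ((i : ℕ) + 1)
        (((finBelow F K (placeOf (pilotDataOfK D K) pp.1 x)).asIdeal.ramificationIdx'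
            (placeOf (pilotDataOfK D K) pp.1 x).asIdeal : ℤ) *
          (qParamOrd E (finBelow F K (placeOf (pilotDataOfK D K) pp.1 x)) : ℤ)) l := by
  rw [cellAt_iff_col_of_not_dvd (pilotDataOfK D K) pp i x hnd hlo hhi, ordq_pilotDataOfK D K hx, pilotDataOfK_l]

/-- **… and a column-NEG cell at the genuine datum refutes H⋆₂₀ there** (every `p`, `e_x`; ties included).
[cite: Mochizuki2012, IUTchI Def. 3.1 (c) p. 61] [claim: Mochizuki2012, status: disputed] -/
theorem not_hStar_pilotDataOfK_of_not_col (pp : Nat.Primes) [Fact (pp : ℕ).Prime] (i : Fin (pilotDataOfK D K).lstar)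
    (x : (thetaIndex (pilotDataOfK D K)).Fibre (.inr pp)) (hx : placeOf (pilotDataOfK D K) pp.1 x ∈ (pilotDataOfK D K).S) {a₀ : ℕ}
    (hlo : ∀ a < a₀, ((pp : ℕ) : ℤ) ^ a * (((pp : ℕ) : ℤ) - 1) < (placeOf (pilotDataOfK D K) pp.1 x).asIdeal.ramificationIdx ℤ)
    (hhi : ((placeOf (pilotDataOfK D K) pp.1 x).asIdeal.ramificationIdx ℤ : ℤ) ≤ ((pp : ℕ) : ℤ) ^ a₀ * (((pp : ℕ) : ℤ) - 1))
    (hneg : ¬ LinearLaw2l ((placeOf (pilotDataOfK D K) pp.1 x).asIdeal.ramificationIdx ℤ : ℤ)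
      (((placeOf (pilotDataOfK D K) pp.1 x).asIdeal.ramificationIdx ℤ / ((pp : ℕ) - 1) + 1 : ℕ) : ℤ)
      (((pp : ℕ) : ℤ) ^ a₀ - ((placeOf (pilotDataOfK D K) pp.1 x).asIdeal.ramificationIdx ℤ : ℤ) * (a₀ : ℤ)) ((i : ℕ) + 1)
      (((finBelow F K (placeOf (pilotDataOfK D K) pp.1 x)).asIdeal.ramificationIdx'
            (placeOf (pilotDataOfK D K) pp.1 x).asIdeal : ℤ) *
          (qParamOrd E (finBelow F K (placeOf (pilotDataOfK D K) pp.1 x)) : ℤ)) l) :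
    ¬ HStar (pilotDataOfK D K) := by
  refine not_hStar_of_not_cellAt (pilotDataOfK D K) pp i x hx (not_cellAt_of_not_col (pilotDataOfK D K) pp i x hlo hhi ?_)
  rwa [ordq_pilotDataOfK D K hx, pilotDataOfK_l]

end Genuine

/-! ## §T5. (typer) Kernel k1 witnesses at named cells of I06STAR-COLUMNS (columns `p, e_w, H, l, j, r_in_ub, r_out_sharp`) -/

/-- **k4 cell vs I06⋆ — HEX:2:11@p7.j5.ev1** (`e_w = 11`, `H = 4` so `ord_w(q) = 44`, `l = 11`, `j = 5`, `r_in_ub = 2`, `r_out_sharp = −4`):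
the `2l`-cleared law HOLDS (`24·44 + 242 = 1298 ≤ 22·96 = 2112`) while I06⋆ is NEG there (col 23,
`Repair.CandInternal2RealStrata.not_mem_pow_smul_logShell_of_root_lt`). [folklore] -/
theorem col_hex_2_11_top_pos : LinearLaw2l 11 2 (-4) 5 44 11 := by
  unfold LinearLaw2l inflation; decide

/-- **… so H⋆₂₀'s cell HOLDS in the kernel at every bad place `x | 7` of local type `e_x = 11` with `ord_x(q) = 44` of ANY pilot datum with
`l = 11`, label `j = 5`** (`6 ∤ 11`; strict turning point `a₀ = 1`: `6 < 11 < 42`) — H⋆₂₀ is NOT I06⋆ renamed. [cite: NeukirchANT1999, Ch. II (5.5)]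
[claim: Mochizuki2012, status: disputed] -/
theorem cellAt_hex_2_11 {F : Type} [Field F] [NumberField F] (X : PilotData F) [h7 : Fact (Nat.Prime 7)] (hl : X.l = 11)
    (i : Fin X.lstar) (hi : (i : ℕ) + 1 = 5) (x : (Thm311.Real.thetaIndex X).Fibre (.inr ⟨7, h7.out⟩))
    (he : (Thm311.Real.placeOf X 7 x).asIdeal.ramificationIdx ℤ = 11) (hq : X.ordq (Thm311.Real.placeOf X 7 x) = 44) :
    CellAt X ⟨7, h7.out⟩ i x := by
  have h := cellAt_iff_col_of_not_dvd X ⟨7, h7.out⟩ i x (a₀ := 1) (by rw [he]; norm_num)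
    (by intro a ha; interval_cases a; rw [he]; norm_num) (by rw [he]; norm_num)
  rw [h, he, hq, hl, hi]
  unfold LinearLaw2l inflation
  norm_num

/-- **Differing cell vs row 15 `slotreach` (k4), lamSeven:k=4:l=23@p7.j11.ev1** (`e_w = 23`, `H = 8`, `m_w = 4`, `r_in_ub = 4`,
`r_out_sharp = 7 − 23 = −16`, top label `j = 11`): the linear law HOLDS by one unit (`120·4 + 23 = 503 ≤ 12·42 = 504`) where row 15's floor cell
`23·⌊(484 − 4)/23⌋ = 460 ≤ 449` FAILS (abc-iut-rh-num-1 HULL-REACH-K1 «15 vs 20: A\B = 20, B\A = 40, CROSS»). [folklore] -/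
theorem law_lamSeven_4_23_top_pos : LinearLaw 23 4 (-16) 11 4 ∧ ¬ ((23 : ℤ) * ((11 ^ 2 * 4 - 4) / 23) ≤ 4 - (-16) + 11 * (23 * (-((-4 : ℤ) / 23)) - (-16))) := by
  refine ⟨by unfold LinearLaw inflation; decide, by decide⟩

/-- **Differing cell in the other direction, HEX:3:5@p7.j2.ev1** (TAME: `e_w = 5`, `m_w = 3`, `c = B = 1`, top label `j = 2`): the linear law
FAILS (`3·3 + 5 = 14 ≤ 3·4 = 12` is false) where the exact tame licence cell (col 37, `(j²−1)·P ≤ j·(e−1) + ((j²·P − 1) mod e)`: `9 ≤ 8 + 1`)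
HOLDS — on tame rows the law is STRICTLY STRONGER than the licence cell (by `1 + ((j²m − 1) mod e)` in `w`-units). [folklore] -/
theorem law_hex_3_5_top_neg : ¬ LinearLaw 5 1 1 2 3 ∧ ((2 : ℤ) ^ 2 - 1) * 3 ≤ 2 * (5 - 1) + (2 ^ 2 * 3 - 1) % 5 := by
  refine ⟨by unfold LinearLaw inflation; decide, by decide⟩

/-- **Declared A6 slice edge (HEX, type `ev1`, `l = 11`: `k₀ = 3`)**: at `e_w = 11`, `(c, B) = (2, −4)`, top label `j = 5` the law HOLDS at
`k = 3` (`m_w = 3`: `83 ≤ 96`) and FAILS at `k = 4` (`m_w = 4`: `107 ≤ 96` false) — abc-iut-rh-num-1's slice `HEX-strip:l11:ev1 → k0 = 3`. [folklore] -/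
theorem slice_hex_l11_ev1 : LinearLaw 11 2 (-4) 5 3 ∧ ¬ LinearLaw 11 2 (-4) 5 4 := by
  refine ⟨by unfold LinearLaw inflation; decide, by unfold LinearLaw inflation; decide⟩

end Summit.ABC.IUTFork.Repair.RH.LinearReachLaw

end
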